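/-
HONEST FRAMING: systematic search; no irrationality claim unless certified.
-/
import Summits.KontsevichZagierPeriods.Zeta5Search.WedgeDictionaryCertKit
import HarnessLib

/-!
# Certificate kit, part 2: the relation families along two-parameter affine families of points

HONEST FRAMING: systematic search; no irrationality claim unless certified.
OUR work (Summit side; cell `pub-zeta5`, planner gen-1 g18, 2026-08-21; memo `pub-zeta5-gen-1/D2-TERMINAL-g17.md` §2).

Continuation of `WedgeDictionaryCertKit`: along a family `pt v u w m t = v + m•u + t•w` every coefficient function of the
STAR / PENCIL / BRIDGE families is a product of two affine forms in `(m, t)` with integer coefficients computed from `(v, u, w)`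
(`starF`, `fanF`, `pencilBaseF`, …); the numeral-form instances `star2`, `pencil2`, `bridge2` take those 18 / 18 / 24 integers
and ONE decidable hypothesis (slot data, moves of the base points, factor data, region data), and `defect_lower` turns the
induction hypothesis of the terminal descent into the vanishing of the defect of a lower member.  Elementary algebra only. [folklore]
-/

noncomputable section

open Finset

namespace Summit.KontsevichZagierPeriods.Zeta5Search.WedgeDictionary

open Summit.KontsevichZagierPeriods.Zeta5Search.DualSeries
open Literature.NumberTheory.Irrationality.BrownZudilin2022 (vwpDual bOfA Converges convergenceForms cellularIntegral QOf)
open Literature.NumberTheory.Transcendental (zetaValue)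

namespace CertKit

/-! ## 6. The coefficient functions along a family: products of two affine forms -/

/-- The affine form `b₀ + 1 − b_i − b_l` along the family. [folklore] -/
def linF (v u w : Vec) (i l : ℕ) : Aff := (1, 0, 0) + bAff v u w 0 - bAff v u w i - bAff v u w l

/-- The two affine factors of `starKappa` along the family. [folklore] -/
def starF (v u w : Vec) (i k : ℕ) : Aff × Aff :=
  (bAff v u w i - bAff v u w k, (1, 0, 0) + bAff v u w 0 - bAff v u w i - bAff v u w k)

/-- The two affine factors of `fanCoeff` along the family (`χ_i` and the non-edge products, slot by slot). [folklore] -/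
def fanF (v u w : Vec) : ℕ → Aff × Aff
  | 1 => (linF v u w 1 6, linF v u w 1 7)
  | 2 => (bAff v u w 2, linF v u w 2 7)
  | 3 => (bAff v u w 3, linF v u w 3 5)
  | 4 => (linF v u w 4 5, linF v u w 4 6)
  | 5 => (linF v u w 5 3, linF v u w 5 4)
  | 6 => (linF v u w 6 1, linF v u w 6 4)
  | 7 => (linF v u w 7 1, linF v u w 7 2)
  | _ => (0, 0)

/-- `χ_i = P_i` on the slots `2, 3`. [folklore] -/
theorem chiOf_eq_self {P : ℕ → ℤ} {i : ℕ} (h : i = 2 ∨ i = 3) : chiOf P i = P i := if_pos h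

/-- `χ_i = 1` off the slots `2, 3`. [folklore] -/
theorem chiOf_eq_one {P : ℕ → ℤ} {i : ℕ} (h : ¬(i = 2 ∨ i = 3)) : chiOf P i = 1 := if_neg h

/-- The two affine factors of `pencilBase` along the family. [folklore] -/
def pencilBaseF (v u w : Vec) : Aff × Aff := (-((1, 0, 0) + bAff v u w 2), (1, 0, 0) + bAff v u w 3)

/-- The two affine factors of `pencilApex` along the family. [folklore] -/
def pencilApexF (v u w : Vec) (i : ℕ) : Aff × Aff :=
  (bAff v u w i + (1, 0, 0), (1, 0, 0) + (1, 0, 0) + bAff v u w 0 - bAff v u w i)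

/-- The two affine factors of `bridgeBase` along the family. [folklore] -/
def bridgeBaseF (v u w : Vec) : Aff × Aff :=
  ((1, 0, 0) + bAff v u w 0 - bAff v u w 7,
    bAff v u w 0 + bAff v u w 0 - bAff v u w 1 - bAff v u w 2 - bAff v u w 3 - bAff v u w 6 - bAff v u w 7)

/-- The two affine factors of `bridgeSlot` along the family. [folklore] -/
def bridgeSlotF (v u w : Vec) : Aff × Aff :=
  (-(bAff v u w 0 - bAff v u w 3 - bAff v u w 7), bAff v u w 0 - bAff v u w 6 - bAff v u w 7)

/-- The two affine factors of `bridgeHalf` along the family. [folklore] -/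
def bridgeHalfF (v u w : Vec) : Aff × Aff :=
  ((1, 0, 0) + bAff v u w 0 - bAff v u w 7, (1, 0, 0) + bAff v u w 0 - bAff v u w 1 - bAff v u w 6)

/-- The two affine factors of `bridgeApex` along the family. [folklore] -/
def bridgeApexF (v u w : Vec) : Aff × Aff := (bAff v u w 1 + (1, 0, 0), bAff v u w 6 + (1, 0, 0))

/-- `starKappa` along the family. [folklore] -/
theorem starKappa_pt (v u w : Vec) (m t : ℕ) {i k : ℕ} (hi : i ≤ 7) (hk : k ≤ 7) :
    starKappa (bOfA (pt v u w m t)) i k = ev (starF v u w i k).1 m t * ev (starF v u w i k).2 m t := by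
  simp only [starKappa, starF, ev_add, ev_sub, ev_one, bOfA_pt v u w m t i hi, bOfA_pt v u w m t k hk,
    bOfA_pt v u w m t 0 (by norm_num)]
  ring

/-- `fanCoeff` along the family. [folklore] -/
theorem fanCoeff_pt (v u w : Vec) (m t : ℕ) {i : ℕ} (hi : i ∈ Icc 1 7) :
    fanCoeff (bOfA (pt v u w m t)) i = ev (fanF v u w i).1 m t * ev (fanF v u w i).2 m t := by
  have hb := bOfA_pt v u w m t
  simp only [mem_Icc] at hi
  obtain ⟨h1, h7⟩ := hi
  interval_cases i
  · rw [fanCoeff, chiOf_eq_one (by decide), show nonEdgePartners 1 = [6, 7] from rfl]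
    simp only [List.map_cons, List.map_nil, List.prod_cons, List.prod_nil, fanF, linF, ev_add, ev_sub, ev_one,
      hb 0 (by norm_num), hb 1 (by norm_num), hb 6 (by norm_num), hb 7 (by norm_num)]
    ring
  · rw [fanCoeff, chiOf_eq_self (by decide), show nonEdgePartners 2 = [7] from rfl]
    simp only [List.map_cons, List.map_nil, List.prod_cons, List.prod_nil, fanF, linF, ev_add, ev_sub, ev_one,
      hb 0 (by norm_num), hb 2 (by norm_num), hb 7 (by norm_num)]
    ring
  · rw [fanCoeff, chiOf_eq_self (by decide), show nonEdgePartners 3 = [5] from rfl]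
    simp only [List.map_cons, List.map_nil, List.prod_cons, List.prod_nil, fanF, linF, ev_add, ev_sub, ev_one,
      hb 0 (by norm_num), hb 3 (by norm_num), hb 5 (by norm_num)]
    ring
  · rw [fanCoeff, chiOf_eq_one (by decide), show nonEdgePartners 4 = [5, 6] from rfl]
    simp only [List.map_cons, List.map_nil, List.prod_cons, List.prod_nil, fanF, linF, ev_add, ev_sub, ev_one,
      hb 0 (by norm_num), hb 4 (by norm_num), hb 5 (by norm_num), hb 6 (by norm_num)]
    ring
  · rw [fanCoeff, chiOf_eq_one (by decide), show nonEdgePartners 5 = [3, 4] from rfl]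
    simp only [List.map_cons, List.map_nil, List.prod_cons, List.prod_nil, fanF, linF, ev_add, ev_sub, ev_one,
      hb 0 (by norm_num), hb 3 (by norm_num), hb 4 (by norm_num), hb 5 (by norm_num)]
    ring
  · rw [fanCoeff, chiOf_eq_one (by decide), show nonEdgePartners 6 = [1, 4] from rfl]
    simp only [List.map_cons, List.map_nil, List.prod_cons, List.prod_nil, fanF, linF, ev_add, ev_sub, ev_one,
      hb 0 (by norm_num), hb 1 (by norm_num), hb 4 (by norm_num), hb 6 (by norm_num)]
    ring
  · rw [fanCoeff, chiOf_eq_one (by decide), show nonEdgePartners 7 = [1, 2] from rfl]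
    simp only [List.map_cons, List.map_nil, List.prod_cons, List.prod_nil, fanF, linF, ev_add, ev_sub, ev_one,
      hb 0 (by norm_num), hb 1 (by norm_num), hb 2 (by norm_num), hb 7 (by norm_num)]
    ring

/-- `pencilBase` along the family. [folklore] -/
theorem pencilBase_pt (v u w : Vec) (m t : ℕ) :
    pencilBase (bOfA (pt v u w m t)) = ev (pencilBaseF v u w).1 m t * ev (pencilBaseF v u w).2 m t := by
  simp only [pencilBase, pencilBaseF, ev_add, ev_neg, ev_one, bOfA_pt v u w m t 2 (by norm_num),
    bOfA_pt v u w m t 3 (by norm_num)]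
  ring

/-- `pencilApex` along the family. [folklore] -/
theorem pencilApex_pt (v u w : Vec) (m t : ℕ) {i : ℕ} (hi : i ≤ 7) :
    pencilApex (bOfA (pt v u w m t)) i = ev (pencilApexF v u w i).1 m t * ev (pencilApexF v u w i).2 m t := by
  simp only [pencilApex, pencilApexF, ev_add, ev_sub, ev_one, bOfA_pt v u w m t i hi,
    bOfA_pt v u w m t 0 (by norm_num)]
  ring

/-- `bridgeBase` along the family. [folklore] -/
theorem bridgeBase_pt (v u w : Vec) (m t : ℕ) :
    bridgeBase (bOfA (pt v u w m t)) = ev (bridgeBaseF v u w).1 m t * ev (bridgeBaseF v u w).2 m t := by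
  simp only [bridgeBase, bridgeBaseF, ev_add, ev_sub, ev_one, bOfA_pt v u w m t 0 (by norm_num),
    bOfA_pt v u w m t 1 (by norm_num), bOfA_pt v u w m t 2 (by norm_num), bOfA_pt v u w m t 3 (by norm_num),
    bOfA_pt v u w m t 6 (by norm_num), bOfA_pt v u w m t 7 (by norm_num)]
  ring

/-- `bridgeSlot` along the family. [folklore] -/
theorem bridgeSlot_pt (v u w : Vec) (m t : ℕ) :
    bridgeSlot (bOfA (pt v u w m t)) = ev (bridgeSlotF v u w).1 m t * ev (bridgeSlotF v u w).2 m t := by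
  simp only [bridgeSlot, bridgeSlotF, ev_sub, ev_neg, bOfA_pt v u w m t 0 (by norm_num),
    bOfA_pt v u w m t 3 (by norm_num), bOfA_pt v u w m t 6 (by norm_num), bOfA_pt v u w m t 7 (by norm_num)]
  ring

/-- `bridgeHalf` along the family. [folklore] -/
theorem bridgeHalf_pt (v u w : Vec) (m t : ℕ) :
    bridgeHalf (bOfA (pt v u w m t)) = ev (bridgeHalfF v u w).1 m t * ev (bridgeHalfF v u w).2 m t := by
  simp only [bridgeHalf, bridgeHalfF, ev_add, ev_sub, ev_one, bOfA_pt v u w m t 0 (by norm_num),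
    bOfA_pt v u w m t 1 (by norm_num), bOfA_pt v u w m t 6 (by norm_num), bOfA_pt v u w m t 7 (by norm_num)]
  ring

/-- `bridgeApex` along the family. [folklore] -/
theorem bridgeApex_pt (v u w : Vec) (m t : ℕ) :
    bridgeApex (bOfA (pt v u w m t)) = ev (bridgeApexF v u w).1 m t * ev (bridgeApexF v u w).2 m t := by
  simp only [bridgeApex, bridgeApexF, ev_add, ev_one, bOfA_pt v u w m t 1 (by norm_num),
    bOfA_pt v u w m t 6 (by norm_num)]

/-! ## 7. The families along an affine family of points, numeral form -/

/-- The region data of a family member: the base point is a region point and both directions have admissible slopes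
(decidable; `region_pt`). [folklore] -/
abbrev RegionData (v u w : Vec) (j : ℕ) : Prop := RegionHyp v j ∧ Slopes u j ∧ Slopes w j

/-- **STAR instance along a family, numeral form.**  The decidable hypothesis checks the slot data, the moves of the base points,
the six affine factors of the three coefficients and the region data of the three points. [folklore] -/
theorem star2 (hcS : CellStar) (hdS : DictStar) (u w : Vec) (m t : ℕ) (v v₁ v₂ : Vec) (i k j₀ j₁ j₂ : ℕ)
    (a₀ a₁ a₂ b₀ b₁ b₂ c₀ c₁ c₂ d₀ d₁ d₂ e₀ e₁ e₂ f₀ f₁ f₂ : ℤ)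
    (h : ((i ∈ Icc 1 7 ∧ k ∈ Icc 1 7 ∧ i ≠ k) ∧ (v + slotDown k = v₁ ∧ v + slotDown i = v₂) ∧
      (starF v u w i k = ((a₀, a₁, a₂), (b₀, b₁, b₂)) ∧ fanF v u w k = ((c₀, c₁, c₂), (d₀, d₁, d₂)) ∧
        fanF v u w i = ((e₀, e₁, e₂), (f₀, f₁, f₂)))) ∧
      (RegionData v u w j₀ ∧ RegionData v₁ u w j₁ ∧ RegionData v₂ u w j₂)) :
    ((a₀ : ℝ) + a₁ * m + a₂ * t) * (b₀ + b₁ * m + b₂ * t) * defect (pt v u w m t) j₀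
      - ((c₀ : ℝ) + c₁ * m + c₂ * t) * (d₀ + d₁ * m + d₂ * t) * defect (pt v₁ u w m t) j₁
      + ((e₀ : ℝ) + e₁ * m + e₂ * t) * (f₀ + f₁ * m + f₂ * t) * defect (pt v₂ u w m t) j₂ = 0 := by
  obtain ⟨⟨⟨hi, hk, hik⟩, ⟨hv₁, hv₂⟩, hs, hfk, hfi⟩, r₀, r₁, r₂⟩ := h
  have g₀ := region_pt r₀ m t
  have hi7 : i ≤ 7 := (mem_Icc.mp hi).2
  have hk7 : k ≤ 7 := (mem_Icc.mp hk).2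
  have e₁ : pt v u w m t + slotDown k = pt v₁ u w m t := pt_add hv₁ u w m t
  have e₂ : pt v u w m t + slotDown i = pt v₂ u w m t := pt_add hv₂ u w m t
  have g₁' : RegionHyp (pt v u w m t + slotDown k) j₁ := by rw [e₁]; exact region_pt r₁ m t
  have g₂' : RegionHyp (pt v u w m t + slotDown i) j₂ := by rw [e₂]; exact region_pt r₂ m t
  have rel := defect_rel3 (hcS _ i k j₀ j₁ j₂ hi hk hik g₀ g₁' g₂') (hdS _ i k j₀ j₁ j₂ hi hk hik g₀ g₁' g₂')
  rw [e₁, e₂, starKappa_pt v u w m t hi7 hk7, fanCoeff_pt v u w m t hk, fanCoeff_pt v u w m t hi, hs, hfk, hfi] at rel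
  simp only [ev] at rel
  push_cast at rel
  linear_combination rel

/-- **PENCIL instance along a family, numeral form.** [folklore] -/
theorem pencil2 (hcP : CellPencil) (hdP : DictPencil) (u w : Vec) (m t : ℕ) (v v₁ v₂ : Vec) (i j₀ j₁ j₂ : ℕ)
    (a₀ a₁ a₂ b₀ b₁ b₂ c₀ c₁ c₂ d₀ d₁ d₂ e₀ e₁ e₂ f₀ f₁ f₂ : ℤ)
    (h : (i ∈ Icc 1 7 ∧ (v + dsUp = v₁ ∧ v + dsUp + slotDown i = v₂) ∧
      (pencilBaseF v u w = ((a₀, a₁, a₂), (b₀, b₁, b₂)) ∧ pencilApexF v u w i = ((c₀, c₁, c₂), (d₀, d₁, d₂)) ∧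
        fanF v₁ u w i = ((e₀, e₁, e₂), (f₀, f₁, f₂)))) ∧
      (RegionData v u w j₀ ∧ RegionData v₁ u w j₁ ∧ RegionData v₂ u w j₂)) :
    ((a₀ : ℝ) + a₁ * m + a₂ * t) * (b₀ + b₁ * m + b₂ * t) * defect (pt v u w m t) j₀
      + ((c₀ : ℝ) + c₁ * m + c₂ * t) * (d₀ + d₁ * m + d₂ * t) * defect (pt v₁ u w m t) j₁
      + ((e₀ : ℝ) + e₁ * m + e₂ * t) * (f₀ + f₁ * m + f₂ * t) * defect (pt v₂ u w m t) j₂ = 0 := by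
  obtain ⟨⟨hi, ⟨hv₁, hv₂⟩, hs, ha, hf⟩, r₀, r₁, r₂⟩ := h
  have g₀ := region_pt r₀ m t
  have hi7 : i ≤ 7 := (mem_Icc.mp hi).2
  have e₁ : pt v u w m t + dsUp = pt v₁ u w m t := pt_add hv₁ u w m t
  have e₂ : pt v u w m t + dsUp + slotDown i = pt v₂ u w m t := by
    rw [e₁]; exact pt_add (by rw [← hv₁]; exact hv₂) u w m t
  have g₁' : RegionHyp (pt v u w m t + dsUp) j₁ := by rw [e₁]; exact region_pt r₁ m t
  have g₂' : RegionHyp (pt v u w m t + dsUp + slotDown i) j₂ := by rw [e₂]; exact region_pt r₂ m t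
  have rel := defect_rel3 (hcP _ i j₀ j₁ j₂ hi g₀ g₁' g₂') (hdP _ i j₀ j₁ j₂ hi g₀ g₁' g₂')
  rw [e₂, e₁, pencilBase_pt v u w m t, pencilApex_pt v u w m t hi7, fanCoeff_pt v₁ u w m t hi, hs, ha, hf] at rel
  simp only [ev] at rel
  push_cast at rel
  linear_combination rel

/-- **BRIDGE instance along a family, numeral form.** [folklore] -/
theorem bridge2 (hcB : CellBridge) (hdB : DictBridge) (u w : Vec) (m t : ℕ) (v v₁ v₂ v₃ : Vec) (j₀ j₁ j₂ j₃ : ℕ)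
    (a₀ a₁ a₂ b₀ b₁ b₂ c₀ c₁ c₂ d₀ d₁ d₂ e₀ e₁ e₂ f₀ f₁ f₂ p₀ p₁ p₂ q₀ q₁ q₂ : ℤ)
    (h : ((v - slotDown 7 = v₁ ∧ v + halfUp457 = v₂ ∧ v + dsUp = v₃) ∧
      (bridgeBaseF v u w = ((a₀, a₁, a₂), (b₀, b₁, b₂)) ∧ bridgeSlotF v u w = ((c₀, c₁, c₂), (d₀, d₁, d₂)) ∧
        bridgeHalfF v u w = ((e₀, e₁, e₂), (f₀, f₁, f₂)) ∧ bridgeApexF v u w = ((p₀, p₁, p₂), (q₀, q₁, q₂)))) ∧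
      (RegionData v u w j₀ ∧ RegionData v₁ u w j₁ ∧ RegionData v₂ u w j₂ ∧ RegionData v₃ u w j₃)) :
    ((a₀ : ℝ) + a₁ * m + a₂ * t) * (b₀ + b₁ * m + b₂ * t) * defect (pt v u w m t) j₀
      + ((c₀ : ℝ) + c₁ * m + c₂ * t) * (d₀ + d₁ * m + d₂ * t) * defect (pt v₁ u w m t) j₁
      + ((e₀ : ℝ) + e₁ * m + e₂ * t) * (f₀ + f₁ * m + f₂ * t) * defect (pt v₂ u w m t) j₂
      + ((p₀ : ℝ) + p₁ * m + p₂ * t) * (q₀ + q₁ * m + q₂ * t) * defect (pt v₃ u w m t) j₃ = 0 := by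
  obtain ⟨⟨⟨hv₁, hv₂, hv₃⟩, hb, hs, hh, ha⟩, r₀, r₁, r₂, r₃⟩ := h
  have g₀ := region_pt r₀ m t
  have e₁ : pt v u w m t - slotDown 7 = pt v₁ u w m t := pt_sub hv₁ u w m t
  have e₂ : pt v u w m t + halfUp457 = pt v₂ u w m t := pt_add hv₂ u w m t
  have e₃ : pt v u w m t + dsUp = pt v₃ u w m t := pt_add hv₃ u w m t
  have g₁' : RegionHyp (pt v u w m t - slotDown 7) j₁ := by rw [e₁]; exact region_pt r₁ m t
  have g₂' : RegionHyp (pt v u w m t + halfUp457) j₂ := by rw [e₂]; exact region_pt r₂ m t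
  have g₃' : RegionHyp (pt v u w m t + dsUp) j₃ := by rw [e₃]; exact region_pt r₃ m t
  have rel := defect_rel4 (hcB _ j₀ j₁ j₂ j₃ g₀ g₁' g₂' g₃') (hdB _ j₀ j₁ j₂ j₃ g₀ g₁' g₂' g₃')
  rw [e₁, e₂, e₃, bridgeBase_pt v u w m t, bridgeSlot_pt v u w m t, bridgeHalf_pt v u w m t,
    bridgeApex_pt v u w m t, hb, hs, hh, ha] at rel
  simp only [ev] at rel
  push_cast at rel
  linear_combination rel

/-- **A known lower point along a family**: from "explicitPQ at every region point of lower level" (the induction hypothesis of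
the terminal descent, relative to the centre `pt v u w m t`) and decidable data, the defect of a lower member vanishes. [folklore] -/
theorem defect_lower {v u w : Vec} {m t : ℕ}
    (IH : ∀ (c : Vec) (j : ℕ), bOfA c 0 < bOfA (pt v u w m t) 0 → RegionHyp c j → ExplicitPQAt c j)
    (v' : Vec) (j : ℕ) (h : bOfA v' 0 < bOfA v 0 ∧ RegionData v' u w j) : defect (pt v' u w m t) j = 0 :=
  defect_of_at (IH _ _ (lt0_pt u w h.1 m t) (region_pt h.2 m t))

end CertKit

end Summit.KontsevichZagierPeriods.Zeta5Search.WedgeDictionary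

end
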